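import Mathlib
import Literature.Computability.AlgebraicComplexity.RealTauKnownCases

/-!
# Route `LacunarySymmetroid` — crux `DoorA26` (stmt-ValiantsHypothesis-19979): the INFLECTION FEWNOMIAL of a lacunary letter
# curve and its Descartes budget `C(K,3) − 1` (all supports, all `K`)

HONEST FRAMING.  Cell `pub-symmetroid`, seat `val-sym-door-p4` (gen 12); helper file `--supports stmt-ValiantsHypothesis-19979`
(`DoorA26 = PosRootLawAt 2 6 19`, OPEN, typed, never asserted here).  A DICTIONARY item for the graft / end-arc reading of door A.

SETTING.  Letters as vectors `v l ∈ ℝ³` (`l : Fin K`) — for a real symmetric `2 × 2` pencil `Σ_l X^{d_l} S_l` take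
`v l = (S_l 00, S_l 01, S_l 11)`, the coordinates of `Sym₂(ℝ) ≅ ℝ³` — and exponents `d l ∈ ℕ`.  The LETTER CURVE is
`W(x) = Σ_l x^{d_l} v_l ∈ ℝ³`, and `x ↦ [W(x)] ∈ ℝP²` is the projective curve whose crossings with the conic `{det = 0}` are the
positive determinant roots.  With the Euler operator `θ = X·d/dX` (which acts diagonally on lacunary sums, `euler_sum`), the rows
`W, θW, θ²W` have coordinates `Σ_l d_l^r v_{l,a} X^{d_l}` (`r = 0,1,2`), and

  `Infl(X) := det [W ; θW ; θ²W]`   (a polynomial; `inflMatrix d v` below, written WITHOUT a `def` as a `Matrix.of`)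

is the INFLECTION FEWNOMIAL: its sign changes on `(0,∞)` are the inflection points of the projective letter curve (at a simple zero
of `Infl` the osculating behaviour of `[W]` flips; standard projective differential geometry, not formalised here — this file is
about the ALGEBRA and the COUNT of `Infl`).

RESULTS (all `K`, all exponent vectors, all letters; `[folklore]` multilinearity + Descartes):
* `det_inflMatrix_eq_sum` — MULTILINEAR EXPANSION: `Infl = Σ_{σ : Fin 3 → Fin K} (Π_r C(d_{σ r}^r)·X^{d_{σ r}}) · C(det[v_{σ 0}; v_{σ 1}; v_{σ 2}])`;
* `det_rows_eq_zero_of_not_injective` — the terms with a repeated letter vanish;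
* `support_det_inflMatrix_subset` — hence the support of `Infl` lies in the set of TRIPLE SUMS `{d_i + d_j + d_k : {i,j,k} ⊆ Fin K, 3-subset}`,
  `card_tripleSums_le` — which has at most `C(K,3)` elements;
* `card_posRoots_det_inflMatrix_lt` — THE INFLECTION BUDGET: if `Infl ≠ 0` it has fewer than `C(K,3)` distinct positive roots
  (tree's sparse Descartes rule `Literature.Computability.AlgebraicComplexity.card_roots_toFinset_filter_pos_lt_card_support`);
  `(2,5)`: `≤ 9`, `(2,6)`: `≤ 19` inflections of the letter curve.

WHY (located reading of this seat, memo DOOR-A26-P4G12-REPORT.md, evidence on 19979; nothing of it is asserted here): every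
located record row of the `m = 2` census is a GRAFT, and the number `γ` of external roots a graft at an end can convert is
bounded by the SECANCY of the END ARC of the letter curve beyond the root span — `γ ≥ 3` needs an inflection on that arc,
`γ = 4` (the only ladder route to a twenty) needs two; the located census finds `ι_end ≤ 1` on every certified `(2,5)` row
(and `ι_end = 1` exactly on the `γ = 3` sources of record).  The budget typed here is the Descartes ceiling of that observable.

Nothing in this file bears on `DoorA26` / `DoorA34` (OPEN), the registers, `MatrixDescartes` (stmt-ValiantsHypothesis-18050) or
`VP ≠ VNP`.  No `def`, no `sorry`; axioms standard.
-/

-- `Summit.ValiantsHypothesis.ValiantsHypothesis.…` repeats a component by the D-0017 layout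
-- (single-conjunct summit), which the `dupNamespace` linter flags; the name is mandated.
set_option linter.dupNamespace false

namespace Summit.ValiantsHypothesis.ValiantsHypothesis.Theorems.LacunarySymmetroid.DoorA26.Inflection

open Polynomial Matrix Finset
open scoped BigOperators

variable {K : ℕ}

/-! ### 1. The Euler operator acts diagonally on lacunary sums -/

/-- `θ = X·d/dX` multiplies the monomial `X^{d_l}` by `d_l`: `X · (Σ_l c_l X^{d_l})' = Σ_l d_l c_l X^{d_l}`.  This is why the rows
`r = 1, 2` of the inflection matrix below are `θW` and `θ²W`. [folklore] -/
theorem euler_sum (d : Fin K → ℕ) (c : Fin K → ℝ) :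
    X * derivative (∑ l, C (c l) * X ^ (d l)) = ∑ l, C ((d l : ℝ) * c l) * X ^ (d l) := by
  rw [derivative_sum, Finset.mul_sum]
  refine Finset.sum_congr rfl fun l _ => ?_
  rw [derivative_C_mul_X_pow]
  rcases Nat.eq_zero_or_pos (d l) with h | h
  · simp [h]
  · obtain ⟨n, hn⟩ : ∃ n, d l = n + 1 := ⟨d l - 1, by omega⟩
    rw [hn, Nat.add_sub_cancel, pow_succ]
    push_cast
    simp only [map_mul, map_add, map_one, map_natCast]
    ring

/-! ### 2. The inflection matrix and its multilinear expansion -/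

/-- Rows of the inflection matrix are finite sums of «one-letter rows»: entry `(r,a)` is `Σ_l C(d_l^r v_{l,a}) X^{d_l}`. [folklore] -/
theorem inflMatrix_row_eq_sum (d : Fin K → ℕ) (v : Fin K → Fin 3 → ℝ) (r : Fin 3) :
    (fun a : Fin 3 => ∑ l, C (((d l : ℝ) ^ (r : ℕ)) * v l a) * X ^ (d l)) =
      ∑ l, (C ((d l : ℝ) ^ (r : ℕ)) * X ^ (d l)) • (fun a : Fin 3 => C (v l a)) := by
  funext a
  simp only [Finset.sum_apply, Pi.smul_apply, smul_eq_mul, map_mul]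
  refine Finset.sum_congr rfl fun l _ => ?_
  ring

/-- A `3 × 3` matrix of constants built from letters `σ 0, σ 1, σ 2` with a REPEATED letter has determinant `0`. [folklore] -/
theorem det_rows_eq_zero_of_not_injective (v : Fin K → Fin 3 → ℝ) (σ : Fin 3 → Fin K)
    (h : ¬ Function.Injective σ) :
    Matrix.det (Matrix.of fun r a => v (σ r) a) = 0 := by
  simp only [Function.Injective, not_forall, exists_prop] at h
  obtain ⟨r, s, hσ, hrs⟩ := h
  exact Matrix.det_zero_of_row_eq hrs (by funext a; simp [hσ])

/-- **Multilinear expansion of the inflection fewnomial.**  For letters `v l ∈ ℝ³` and exponents `d l`,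
`det [ Σ_l C(d_l^r v_{l,a}) X^{d_l} ]_{r,a} = Σ_{σ : Fin 3 → Fin K} (Π_r C(d_{σ r}^r) X^{d_{σ r}}) · C(det [v_{σ r, a}]_{r,a})`
(determinant is multilinear in the rows; each one-letter row is a scalar polynomial times a constant vector). [folklore] -/
theorem det_inflMatrix_eq_sum (d : Fin K → ℕ) (v : Fin K → Fin 3 → ℝ) :
    Matrix.det (Matrix.of fun (r : Fin 3) (a : Fin 3) => ∑ l, C (((d l : ℝ) ^ (r : ℕ)) * v l a) * X ^ (d l)) =
      ∑ σ : Fin 3 → Fin K, (∏ r, C ((d (σ r) : ℝ) ^ (r : ℕ)) * X ^ (d (σ r))) *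
        C (Matrix.det (Matrix.of fun r a => v (σ r) a)) := by
  classical
  let g : Fin 3 → Fin K → (Fin 3 → ℝ[X]) :=
    fun r l => (C ((d l : ℝ) ^ (r : ℕ)) * X ^ (d l)) • (fun a => C (v l a))
  have hrows : (Matrix.of fun (r : Fin 3) (a : Fin 3) => ∑ l, C (((d l : ℝ) ^ (r : ℕ)) * v l a) * X ^ (d l)) =
      fun r => ∑ l ∈ (univ : Finset (Fin K)), g r l := by
    funext r a
    change (∑ l, C (((d l : ℝ) ^ (r : ℕ)) * v l a) * X ^ (d l)) = (∑ l ∈ univ, g r l) a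
    rw [Finset.sum_apply]
    refine Finset.sum_congr rfl fun l _ => ?_
    simp only [g, Pi.smul_apply, smul_eq_mul, map_mul]
    ring
  let D : MultilinearMap ℝ[X] (fun _ : Fin 3 => Fin 3 → ℝ[X]) ℝ[X] :=
    (Matrix.detRowAlternating : (Fin 3 → ℝ[X]) [⋀^Fin 3]→ₗ[ℝ[X]] ℝ[X]).toMultilinearMap
  have hD : ∀ M : Matrix (Fin 3) (Fin 3) ℝ[X], M.det = D M := fun M => rfl
  rw [hD, hrows, MultilinearMap.map_sum_finset D g (fun _ => univ), Fintype.piFinset_univ]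
  refine Finset.sum_congr rfl fun σ _ => ?_
  have hsm := MultilinearMap.map_smul_univ D (fun r : Fin 3 => C ((d (σ r) : ℝ) ^ (r : ℕ)) * X ^ (d (σ r)))
    (fun r a => C (v (σ r) a))
  have hg : (fun r => g r (σ r)) = fun r => (C ((d (σ r) : ℝ) ^ (r : ℕ)) * X ^ (d (σ r))) • (fun a => C (v (σ r) a)) := rfl
  rw [hg, hsm, smul_eq_mul]
  have hmap : (fun r a => C (v (σ r) a) : Fin 3 → Fin 3 → ℝ[X]) = (Matrix.of fun r a => v (σ r) a).map C := by
    funext r a; simp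
  have hDm : D (fun r a => C (v (σ r) a)) = C (Matrix.det (Matrix.of fun r a => v (σ r) a)) := by
    rw [← hD, hmap, ← RingHom.mapMatrix_apply, ← RingHom.map_det]
  rw [hDm]

/-! ### 3. Support in the triple sums and the Descartes budget -/

/-- A product of monomials is a monomial: `Π_r C(c_r) X^{n_r} = C(Π_r c_r) X^{Σ_r n_r}`. [folklore] -/
theorem prod_C_mul_X_pow {ι : Type*} (s : Finset ι) (c : ι → ℝ) (n : ι → ℕ) :
    ∏ r ∈ s, C (c r) * X ^ (n r) = C (∏ r ∈ s, c r) * X ^ (∑ r ∈ s, n r) := by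
  rw [Finset.prod_mul_distrib, map_prod, Finset.prod_pow_eq_pow_sum]

/-- Each term of the multilinear expansion is ONE monomial, with exponent the triple sum `Σ_r d_{σ r}` and coefficient
`(Π_r d_{σ r}^r) · det[v_{σ r}]`. [folklore] -/
theorem term_eq_monomial (d : Fin K → ℕ) (v : Fin K → Fin 3 → ℝ) (σ : Fin 3 → Fin K) :
    (∏ r, C ((d (σ r) : ℝ) ^ (r : ℕ)) * X ^ (d (σ r))) * C (Matrix.det (Matrix.of fun r a => v (σ r) a)) =
      C ((∏ r, (d (σ r) : ℝ) ^ (r : ℕ)) * Matrix.det (Matrix.of fun r a => v (σ r) a)) *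
        X ^ (∑ r, d (σ r)) := by
  rw [prod_C_mul_X_pow, map_mul]
  ring

/-- The TRIPLE SUMS of an exponent vector: `{Σ_{i ∈ s} d_i : s ⊆ Fin K, |s| = 3}` — written inline as
`(univ.powersetCard 3).image (fun s => ∑ i ∈ s, d i)`; there are at most `C(K,3)` of them. [folklore] -/
theorem card_tripleSums_le (d : Fin K → ℕ) :
    (((univ : Finset (Fin K)).powersetCard 3).image (fun s => ∑ i ∈ s, d i)).card ≤ Nat.choose K 3 := by
  refine Finset.card_image_le.trans ?_
  rw [Finset.card_powersetCard, Finset.card_univ, Fintype.card_fin]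

/-- For an INJECTIVE choice of letters `σ : Fin 3 → Fin K` the exponent `Σ_r d_{σ r}` is a triple sum. [folklore] -/
theorem sum_mem_tripleSums (d : Fin K → ℕ) (σ : Fin 3 → Fin K) (hσ : Function.Injective σ) :
    ∑ r, d (σ r) ∈ ((univ : Finset (Fin K)).powersetCard 3).image (fun s => ∑ i ∈ s, d i) := by
  classical
  refine Finset.mem_image.mpr ⟨univ.image σ, ?_, ?_⟩
  · rw [Finset.mem_powersetCard]
    exact ⟨Finset.subset_univ _, by rw [Finset.card_image_of_injective _ hσ, Finset.card_univ, Fintype.card_fin]⟩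
  · rw [Finset.sum_image (fun x _ y _ h => hσ h)]

/-- **Support of the inflection fewnomial.**  Every exponent occurring in `Infl = det[W; θW; θ²W]` is a triple sum
`d_i + d_j + d_k` of three DISTINCT letters (terms with a repeated letter vanish). [folklore] -/
theorem support_det_inflMatrix_subset (d : Fin K → ℕ) (v : Fin K → Fin 3 → ℝ) :
    (Matrix.det (Matrix.of fun (r : Fin 3) (a : Fin 3) =>
        ∑ l, C (((d l : ℝ) ^ (r : ℕ)) * v l a) * X ^ (d l))).support ⊆
      ((univ : Finset (Fin K)).powersetCard 3).image (fun s => ∑ i ∈ s, d i) := by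
  classical
  intro n hn
  rw [Polynomial.mem_support_iff, det_inflMatrix_eq_sum, Polynomial.finsetSum_coeff] at hn
  by_contra hnot
  apply hn
  refine Finset.sum_eq_zero fun σ _ => ?_
  rw [term_eq_monomial, Polynomial.coeff_C_mul_X_pow]
  by_cases hσ : Function.Injective σ
  · have hne : n ≠ ∑ r, d (σ r) := fun h => hnot (h ▸ sum_mem_tripleSums d σ hσ)
    simp [hne]
  · simp [det_rows_eq_zero_of_not_injective v σ hσ]

/-- **THE INFLECTION BUDGET (all supports, all `K`).**  If the inflection fewnomial `Infl = det[W; θW; θ²W]` of the letter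
curve `W(x) = Σ_l x^{d_l} v_l` is not identically zero, it has FEWER THAN `C(K,3)` distinct positive roots — the letter curve of a
`K`-letter pencil has at most `C(K,3) − 1` (sign-change) inflections: `9` at `(2,5)`, `19` at `(2,6)`.  Descartes' rule (sparse
form, tree lemma `Literature.Computability.AlgebraicComplexity.card_roots_toFinset_filter_pos_lt_card_support`) on the support bound.
[folklore] -/
theorem card_posRoots_det_inflMatrix_lt (d : Fin K → ℕ) (v : Fin K → Fin 3 → ℝ)
    (h : Matrix.det (Matrix.of fun (r : Fin 3) (a : Fin 3) =>
        ∑ l, C (((d l : ℝ) ^ (r : ℕ)) * v l a) * X ^ (d l)) ≠ 0) :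
    ((Matrix.det (Matrix.of fun (r : Fin 3) (a : Fin 3) =>
        ∑ l, C (((d l : ℝ) ^ (r : ℕ)) * v l a) * X ^ (d l))).roots.toFinset.filter (0 < ·)).card < Nat.choose K 3 := by
  refine (Literature.Computability.AlgebraicComplexity.card_roots_toFinset_filter_pos_lt_card_support h).trans_le ?_
  exact (Finset.card_le_card (support_det_inflMatrix_subset d v)).trans (card_tripleSums_le d)

/-! ### 4. Pencil currency: the letter curve of a real symmetric `2 × 2` lacunary pencil -/

/-- **Inflection budget in pencil currency.**  For a real symmetric `2 × 2` `K`-letter pencil `Σ_l X^{d_l} S_l`, take the letter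
vectors `v_l = (S_l 00, S_l 01, S_l 11)` (coordinates of `Sym₂(ℝ) ≅ ℝ³`; any other linear coordinates multiply `Infl` by a non-zero
constant).  If the inflection fewnomial of the letter curve `x ↦ [Σ_l x^{d_l} S_l] ∈ ℙ(Sym₂ ℝ)` is not identically zero, it has fewer
than `C(K,3)` distinct positive roots. [folklore] -/
theorem card_posRoots_inflection_pencil_lt (d : Fin K → ℕ) (S : Fin K → Matrix (Fin 2) (Fin 2) ℝ)
    (h : Matrix.det (Matrix.of fun (r : Fin 3) (a : Fin 3) =>
        ∑ l, C (((d l : ℝ) ^ (r : ℕ)) * (![S l 0 0, S l 0 1, S l 1 1] : Fin 3 → ℝ) a) * X ^ (d l)) ≠ 0) :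
    ((Matrix.det (Matrix.of fun (r : Fin 3) (a : Fin 3) =>
        ∑ l, C (((d l : ℝ) ^ (r : ℕ)) * (![S l 0 0, S l 0 1, S l 1 1] : Fin 3 → ℝ) a) * X ^ (d l))).roots.toFinset.filter
          (0 < ·)).card < Nat.choose K 3 :=
  card_posRoots_det_inflMatrix_lt d (fun l => ![S l 0 0, S l 0 1, S l 1 1]) h

/-- **`(2,5)`: at most `9` inflections.**  The letter curve of a five-letter symmetric `2 × 2` pencil (the core of every located
`(2,6)` graft) has an inflection fewnomial with at most `9 = C(5,3) − 1` distinct positive roots, if it is not identically zero. [folklore] -/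
theorem card_posRoots_inflection_two_five_le (d : Fin 5 → ℕ) (S : Fin 5 → Matrix (Fin 2) (Fin 2) ℝ)
    (h : Matrix.det (Matrix.of fun (r : Fin 3) (a : Fin 3) =>
        ∑ l, C (((d l : ℝ) ^ (r : ℕ)) * (![S l 0 0, S l 0 1, S l 1 1] : Fin 3 → ℝ) a) * X ^ (d l)) ≠ 0) :
    ((Matrix.det (Matrix.of fun (r : Fin 3) (a : Fin 3) =>
        ∑ l, C (((d l : ℝ) ^ (r : ℕ)) * (![S l 0 0, S l 0 1, S l 1 1] : Fin 3 → ℝ) a) * X ^ (d l))).roots.toFinset.filter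
          (0 < ·)).card ≤ 9 := by
  have := card_posRoots_inflection_pencil_lt d S h
  simp only [Nat.choose] at this
  omega

/-- **`(2,6)`: at most `19` inflections.**  The letter curve of a six-letter symmetric `2 × 2` pencil (the format of door A) has an
inflection fewnomial with at most `19 = C(6,3) − 1` distinct positive roots, if it is not identically zero. [folklore] -/
theorem card_posRoots_inflection_two_six_le (d : Fin 6 → ℕ) (S : Fin 6 → Matrix (Fin 2) (Fin 2) ℝ)
    (h : Matrix.det (Matrix.of fun (r : Fin 3) (a : Fin 3) =>
        ∑ l, C (((d l : ℝ) ^ (r : ℕ)) * (![S l 0 0, S l 0 1, S l 1 1] : Fin 3 → ℝ) a) * X ^ (d l)) ≠ 0) :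
    ((Matrix.det (Matrix.of fun (r : Fin 3) (a : Fin 3) =>
        ∑ l, C (((d l : ℝ) ^ (r : ℕ)) * (![S l 0 0, S l 0 1, S l 1 1] : Fin 3 → ℝ) a) * X ^ (d l))).roots.toFinset.filter
          (0 < ·)).card ≤ 19 := by
  have := card_posRoots_inflection_pencil_lt d S h
  simp only [Nat.choose] at this
  omega

end Summit.ValiantsHypothesis.ValiantsHypothesis.Theorems.LacunarySymmetroid.DoorA26.Inflection
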